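import Literature.NumberTheory.Sieve.AsymptoticSieveForPrimesTheorem2Identities
import Literature.NumberTheory.Sieve.FriedlanderIwaniecPrimesProp21
import Literature.NumberTheory.Sieve.DivisorPowerSums
import Literature.NumberTheory.Sieve.AsymptoticSieveForPrimesReduction
import HarnessLib

/-!
# Asymptotic sieve for primes, Theorem 2: counting lemmas, the `ω`-divisor lemma and the moments `∑ a_n c^{ω(n)}`

Topic `Literature/NumberTheory/Sieve` (trunk T-SIEVE), sequel of `…Theorem2Identities`. Source:
J. Friedlander, H. Iwaniec, *Asymptotic sieve for primes*, Ann. of Math. 148 (1998) 1041–1065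
[FriedlanderIwaniecASP1998] (= arXiv:math/9811186), §9 pp. 1059–1062 (Lemma 2 and the estimates
`E₁`, `E₂₁`, `E₂₂`, `S₂` in the proof of Theorem 2).

The elementary counting tools for the estimation of the error functionals `RS`, `ES`, `TG` of
`…Theorem2Identities`, for a GENERAL sifted sequence. Throughout, the divisor-function weights
`τ(n)` of FI's text are replaced by the number of squarefree divisors `2^{ω(n)}`, which is what the
inclusion–exclusion over squarefree `d` and squarefree `ν` actually produces and which has much
smaller moments against `a_n` (this is how the tree affords integral exponents in Lemma 2):

* `card_filter_dvd_le_two_pow` — `#{d ∈ 𝒟 : d ∣ n} ≤ 2^{ω(n)}` for squarefree `d`;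
  `card_filter_prod_sq_dvd_le_two_pow` — `#{L : ℓ_L² ∣ n} ≤ 2^{ω(n)}`;
  `card_filter_dvd_le_three_pow` — `#{b ∈ ℬ : b ∣ n} ≤ 3^{ω(n)}` for cubefree `b` (`b ∣ rad(n)²`);
  `card_fibre_lcm_le_two_pow` — `#{(d, L) : lcm(d, ℓ_L²) = b} ≤ 2^{ω(b)}` (FI p. 1061: "every `k`
  has at most `τ(k)` representations as `k = [ν², d]`");
* `exists_squarefree_divisor_card_primeFactors_le` — the `ω`-form of FI's Lemma 2 (`k = 3`): every
  `n ≥ 1` has a squarefree divisor `d` with `d³ ≤ n` and `ω(n) ≤ 3ω(d) + 2`, i.e.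
  `2^{ω(n)} ≤ 4 · τ(d)³`;
* `SieveSequence.sum_a_mul_two_pow_card_primeFactors_le` — the moments
  `∑_{n ≤ x} a_n 2^{kω(n)} ≤ 4^k K₈ V_{3k+8}(x^{1/3}) A(x)`, `V_r(y) = ∑_{d ≤ y} τ(d)^r/d`, from the
  crude bound (1.6)/(2.8) `A_d(x) ≤ K₈ τ(d)⁸ d⁻¹ A(x)` (`d ≤ x^{1/3}`) (FI p. 1062, `S₂`);
* `density_nonneg_of_isCubefree`, `sum_cubefree_pow_mul_density_le` —
  `∑_{b ≤ M cubefree} c^{ω(b)} g(b) ≤ ∏_{p ≤ M} (1 + c g(p) + c g(p²))` (FI p. 1060: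
  "`∑³ τ(d)^{10} g(d) ≤ ∏_{p ≤ x} (1 + 2^{10} g(p) + 3^{10} g(p²))`").

## References

* J. Friedlander, H. Iwaniec, *Asymptotic sieve for primes*, Ann. of Math. 148 (1998), 1041–1065,
  §9 Lemma 2 and pp. 1060–1062. [cite: FriedlanderIwaniecASP1998, §9 Lemma 2]

## Mathlib / tree search

Tree (reused): `exists_subset_prod_pow_three_le`, `card_divisors_prod_prime_pow`,
`sum_Icc_le_prod_primesLE_sum` (`FriedlanderIwaniecPrimesProp21`), `squarefree_prod_of_primes`
(`…SquarefreeProofs`), `card_divisors_of_squarefree`, `prod_one_add_le_exp_sum` (`…Reduction`), `IsCubefree`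
(`FriedlanderIwaniecPrimes`). Mathlib: `Nat.primeFactors_mono`, `Nat.factorization_le_iff_dvd`,
`Nat.eq_of_factorization_eq`, `Finset.card_le_card_of_injOn`, `Finset.sum_fiberwise_of_maps_to`.
`lean search 'card_fibre_lcm|two_pow_card_primeFactors_le'`: nothing before this file.
-/

noncomputable section

open Filter Finset Real
open scoped ArithmeticFunction.sigma

namespace Literature.NumberTheory.Sieve

open FriedlanderIwaniecPrimesSquarefree FriedlanderIwaniecPrimes

/-! ### Counting squarefree and cubefree divisors by `2^{ω}`, `3^{ω}` -/

/-- `#{d ∈ 𝒟 : d ∣ n} ≤ 2^{ω(n)}` when `𝒟` consists of squarefree numbers and `n ≠ 0`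
(`d ↦ primeFactors d` is injective on squarefree `d` and lands in the subsets of `primeFactors n`).
[folklore] -/
theorem card_filter_dvd_le_two_pow (𝒟 : Finset ℕ) (h𝒟 : ∀ d ∈ 𝒟, Squarefree d) {n : ℕ}
    (hn : n ≠ 0) : #{d ∈ 𝒟 | d ∣ n} ≤ 2 ^ n.primeFactors.card := by
  rw [← Finset.card_powerset]
  refine Finset.card_le_card_of_injOn Nat.primeFactors (fun d hd => ?_) ?_
  · have hd' := Finset.mem_filter.mp hd
    exact Finset.mem_coe.mpr (Finset.mem_powerset.mpr (Nat.primeFactors_mono hd'.2 hn))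
  · intro d hd e he hde
    have hd' := h𝒟 d (Finset.mem_filter.mp (Finset.mem_coe.mp hd)).1
    have he' := h𝒟 e (Finset.mem_filter.mp (Finset.mem_coe.mp he)).1
    rw [← Nat.prod_primeFactors_of_squarefree hd', ← Nat.prod_primeFactors_of_squarefree he', hde]

/-- `#{L ∈ PL : ℓ_L² ∣ n} ≤ 2^{ω(n)}` when `PL` consists of sets of primes and `n ≠ 0`. [folklore] -/
theorem card_filter_prod_sq_dvd_le_two_pow (PL : Finset (Finset ℕ))
    (hPL : ∀ L ∈ PL, ∀ p ∈ L, p.Prime) {n : ℕ} (hn : n ≠ 0) :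
    #{L ∈ PL | (∏ p ∈ L, p) ^ 2 ∣ n} ≤ 2 ^ n.primeFactors.card := by
  rw [← Finset.card_powerset]
  refine Finset.card_le_card_of_injOn id (fun L hL => ?_) (Set.injOn_id _)
  have hL' := Finset.mem_filter.mp hL
  refine Finset.mem_coe.mpr (Finset.mem_powerset.mpr fun p hp => ?_)
  have hpp := hPL L hL'.1 p hp
  refine Nat.mem_primeFactors.mpr ⟨hpp, ?_, hn⟩
  exact (Finset.dvd_prod_of_mem _ hp).trans ((dvd_pow_self _ two_ne_zero).trans hL'.2)

/-- A cubefree divisor of `n` divides `rad(n)² = ∏_{p ∣ n} p²`. [folklore] -/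
theorem dvd_prod_primeFactors_sq_of_isCubefree {b n : ℕ} (hb : IsCubefree b) (hbn : b ∣ n)
    (hn : n ≠ 0) : b ∣ ∏ p ∈ n.primeFactors, p ^ 2 := by
  have hb0 : b ≠ 0 := ne_zero_of_dvd_ne_zero hn hbn
  have hP0 : ∏ p ∈ n.primeFactors, p ^ 2 ≠ 0 :=
    Finset.prod_ne_zero_iff.mpr fun p hp => pow_ne_zero 2 (Nat.prime_of_mem_primeFactors hp).ne_zero
  rw [← Nat.factorization_le_iff_dvd hb0 hP0]
  intro p
  rw [Nat.factorization_prod fun q hq => pow_ne_zero 2 (Nat.prime_of_mem_primeFactors hq).ne_zero]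
  simp only [Finsupp.coe_finsetSum, Finset.sum_apply, Nat.factorization_pow, Finsupp.coe_smul,
    Pi.smul_apply, smul_eq_mul]
  by_cases hp : p ∈ b.primeFactors
  · have hpn : p ∈ n.primeFactors := Nat.primeFactors_mono hbn hn hp
    calc b.factorization p ≤ 2 := hb p hp
      _ = 2 * (p.factorization p) := by
          rw [(Nat.prime_of_mem_primeFactors hp).factorization_self]
      _ ≤ ∑ q ∈ n.primeFactors, 2 * q.factorization p :=
          Finset.single_le_sum (f := fun q => 2 * q.factorization p) (fun q _ => Nat.zero_le _) hpn
  · rw [Finsupp.notMem_support_iff.mp (by rwa [Nat.support_factorization])]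
    exact Nat.zero_le _

/-- `τ(∏_{p ∣ n} p²) = 3^{ω(n)}`. [folklore] -/
theorem card_divisors_prod_primeFactors_sq (n : ℕ) :
    #(∏ p ∈ n.primeFactors, p ^ 2).divisors = 3 ^ n.primeFactors.card := by
  rw [card_divisors_prod_prime_pow n.primeFactors (fun p hp => Nat.prime_of_mem_primeFactors hp)
    (fun _ => 2), Finset.prod_const]

/-- `#{b ∈ ℬ : b ∣ n} ≤ 3^{ω(n)}` when `ℬ` consists of cubefree numbers and `n ≠ 0`. [folklore] -/
theorem card_filter_dvd_le_three_pow (ℬ : Finset ℕ) (hℬ : ∀ b ∈ ℬ, IsCubefree b) {n : ℕ}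
    (hn : n ≠ 0) : #{b ∈ ℬ | b ∣ n} ≤ 3 ^ n.primeFactors.card := by
  rw [← card_divisors_prod_primeFactors_sq n]
  refine Finset.card_le_card fun b hb => ?_
  have hb' := Finset.mem_filter.mp hb
  have hP0 : ∏ p ∈ n.primeFactors, p ^ 2 ≠ 0 :=
    Finset.prod_ne_zero_iff.mpr fun p hp => pow_ne_zero 2 (Nat.prime_of_mem_primeFactors hp).ne_zero
  exact Nat.mem_divisors.mpr ⟨dvd_prod_primeFactors_sq_of_isCubefree (hℬ b hb'.1) hb'.2 hn, hP0⟩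

/-- In `b = lcm(d, ℓ_L²)` with `d` squarefree and `L` a set of primes, `L` is determined by `b`: a prime
`p` lies in `L` iff `p² ∣ b`. [folklore] -/
theorem mem_iff_sq_dvd_of_lcm_eq {d b p : ℕ} {L : Finset ℕ} (hd : Squarefree d)
    (hL : ∀ q ∈ L, q.Prime) (hp : p.Prime) (h : Nat.lcm d ((∏ q ∈ L, q) ^ 2) = b) :
    p ∈ L ↔ p ^ 2 ∣ b := by
  constructor
  · intro hpL
    rw [← h]
    exact (pow_dvd_pow_of_dvd (Finset.dvd_prod_of_mem _ hpL) 2).trans (Nat.dvd_lcm_right _ _)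
  · intro hpb
    by_contra hpL
    have hndvd : ¬p ∣ ∏ q ∈ L, q := by
      rw [Prime.dvd_finsetProd_iff hp.prime]
      rintro ⟨q, hq, hpq⟩
      exact hpL (((Nat.prime_dvd_prime_iff_eq hp (hL q hq)).mp hpq) ▸ hq)
    have hcop : (p ^ 2).Coprime ((∏ q ∈ L, q) ^ 2) :=
      Nat.Coprime.pow 2 2 ((Nat.Prime.coprime_iff_not_dvd hp).mpr hndvd)
    have h1 : p ^ 2 ∣ d * (∏ q ∈ L, q) ^ 2 := hpb.trans (h ▸ Nat.lcm_dvd_mul d _)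
    have h2 : p ^ 2 ∣ d := hcop.dvd_of_dvd_mul_right h1
    have := hd p (by rw [← pow_two]; exact h2)
    exact hp.not_isUnit this

/-- **Fibres of `(d, L) ↦ lcm(d, ℓ_L²)`** (FI p. 1061: "every `k` has at most `τ(k)` representations
as `k = [ν², d]` and `k` is cubefree if it has any"; here with squarefree `d` counted by `2^{ω(k)}`):
for squarefree `d ∈ 𝒟` and sets of primes `L ∈ PL`,
`#{(d, L) : lcm(d, ℓ_L²) = b} ≤ 2^{ω(b)}` (`L` is determined by `b`, and `d ∣ b` is squarefree).
[cite: FriedlanderIwaniecASP1998, §9 p. 1061] -/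
theorem card_fibre_lcm_le_two_pow (𝒟 : Finset ℕ) (h𝒟 : ∀ d ∈ 𝒟, Squarefree d)
    (PL : Finset (Finset ℕ)) (hPL : ∀ L ∈ PL, ∀ p ∈ L, p.Prime) {b : ℕ} (hb : b ≠ 0) :
    #{q ∈ 𝒟 ×ˢ PL | Nat.lcm q.1 ((∏ p ∈ q.2, p) ^ 2) = b} ≤ 2 ^ b.primeFactors.card := by
  rw [← Finset.card_powerset]
  refine Finset.card_le_card_of_injOn (fun q => q.1.primeFactors) (fun q hq => ?_) ?_
  · have hq' := Finset.mem_filter.mp hq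
    refine Finset.mem_coe.mpr (Finset.mem_powerset.mpr (Nat.primeFactors_mono ?_ hb))
    rw [← hq'.2]; exact Nat.dvd_lcm_left _ _
  · intro q hq q' hq' hqq'
    have hq1 := Finset.mem_filter.mp (Finset.mem_coe.mp hq)
    have hq1' := Finset.mem_filter.mp (Finset.mem_coe.mp hq')
    obtain ⟨hd, hL⟩ := Finset.mem_product.mp hq1.1
    obtain ⟨hd', hL'⟩ := Finset.mem_product.mp hq1'.1
    have hqq'' : q.1.primeFactors = q'.1.primeFactors := hqq'
    have h1 : q.1 = q'.1 := by
      rw [← Nat.prod_primeFactors_of_squarefree (h𝒟 _ hd),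
        ← Nat.prod_primeFactors_of_squarefree (h𝒟 _ hd'), hqq'']
    have h2 : q.2 = q'.2 := by
      ext p
      by_cases hp : p.Prime
      · rw [mem_iff_sq_dvd_of_lcm_eq (h𝒟 _ hd) (hPL _ hL) hp hq1.2,
          mem_iff_sq_dvd_of_lcm_eq (h𝒟 _ hd') (hPL _ hL') hp hq1'.2]
      · exact ⟨fun h => absurd (hPL _ hL p h) hp, fun h => absurd (hPL _ hL' p h) hp⟩
    exact Prod.ext h1 h2

/-! ### The `ω`-divisor lemma (FI's Lemma 2, `k = 3`, squarefree form) -/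

/-- **`ω`-form of FI's Lemma 2** (`k = 3`): every `n ≥ 1` has a SQUAREFREE divisor `d` with `d³ ≤ n`
and `ω(n) ≤ 3 ω(d) + 2` (so `2^{ω(n)} ≤ 4 · 2^{3ω(d)} = 4 τ(d)³`). Take for `d` the product of a
suitable third of the prime factors of `n` (`exists_subset_prod_pow_three_le`: among any set of
positive integers `S` there is `T ⊆ S` with `(∏ T)³ ≤ ∏ S` and `#S ≤ 3#T + 2`).
[cite: FriedlanderIwaniecASP1998, §9 Lemma 2] -/
theorem exists_squarefree_divisor_card_primeFactors_le (n : ℕ) (hn : n ≠ 0) :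
    ∃ d : ℕ, d ∣ n ∧ Squarefree d ∧ d ^ 3 ≤ n ∧
      n.primeFactors.card ≤ 3 * d.primeFactors.card + 2 := by
  obtain ⟨T, hTS, hTprod, hTcard⟩ := exists_subset_prod_pow_three_le n.primeFactors
    (fun p hp => (Nat.prime_of_mem_primeFactors hp).one_le)
  have hTp : ∀ p ∈ T, p.Prime := fun p hp => Nat.prime_of_mem_primeFactors (hTS hp)
  refine ⟨∏ p ∈ T, p, ?_, squarefree_prod_of_primes hTp, ?_, ?_⟩
  · exact (Finset.prod_dvd_prod_of_subset _ _ _ hTS).trans (Nat.prod_primeFactors_dvd n)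
  · exact hTprod.trans (Nat.le_of_dvd (Nat.pos_of_ne_zero hn) (Nat.prod_primeFactors_dvd n))
  · rwa [Nat.primeFactors_prod hTp]

/-! ### The moments `∑_{n ≤ x} a_n 2^{k ω(n)}` from the crude bound (1.6)/(2.8) -/

namespace SieveSequence

/-- **Moments of `2^{kω(n)}` against `a_n`** (FI p. 1062, the estimate of `S₂`, in `ω`-form): if
`A_d(x) ≤ K₈ τ(d)⁸ d⁻¹ A(x)` for all `1 ≤ d ≤ x^{1/3}` ((1.6) = (2.8) at `x`), then
`∑_{n ≤ x} a_n 2^{kω(n)} ≤ 4^k K₈ (∑_{d ≤ x^{1/3}} τ(d)^{3k+8}/d) A(x)`: by the `ω`-divisor lemma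
`2^{kω(n)} ≤ 4^k τ(d_n)^{3k}` for a squarefree `d_n ∣ n` with `d_n ≤ n^{1/3} ≤ x^{1/3}`, and
`∑_{n : d_n = d} a_n ≤ A_d(x)`. [cite: FriedlanderIwaniecASP1998, §9 p. 1062] -/
theorem sum_a_mul_two_pow_card_primeFactors_le (A : SieveSequence) (k : ℕ) {K₈ x : ℝ} (hx : 0 ≤ x)
    (h16 : ∀ d : ℕ, 1 ≤ d → (d : ℝ) ≤ x ^ (1 / 3 : ℝ) →
      A.congrSum d x ≤ K₈ * (σ 0 d : ℝ) ^ 8 / d * A.size x) :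
    ∑ n ∈ Ioc 0 ⌊x⌋₊, A.a n * (2 : ℝ) ^ (k * n.primeFactors.card) ≤
      4 ^ k * K₈ * (∑ d ∈ Icc 1 ⌊x ^ (1 / 3 : ℝ)⌋₊, (σ 0 d : ℝ) ^ (3 * k + 8) / d) * A.size x := by
  classical
  -- the divisor selector
  choose! dsel hdsel using fun n : ℕ => fun hn : n ≠ 0 =>
    exists_squarefree_divisor_card_primeFactors_le n hn
  set X := ⌊x⌋₊ with hX
  set Y := ⌊x ^ (1 / 3 : ℝ)⌋₊ with hY
  set S := Icc 1 Y with hS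
  -- pointwise: `a_n 2^{kω(n)} ≤ a_n 4^k τ(d_n)^{3k}`
  have hpt : ∀ n ∈ Ioc 0 X, A.a n * (2 : ℝ) ^ (k * n.primeFactors.card) ≤
      A.a n * ((4 : ℝ) ^ k * ((σ 0 (dsel n) : ℝ)) ^ (3 * k)) := by
    intro n hn
    have hn0 : n ≠ 0 := (Finset.mem_Ioc.mp hn).1.ne'
    obtain ⟨-, hsq, -, hcard⟩ := hdsel n hn0
    refine mul_le_mul_of_nonneg_left ?_ (A.a_nonneg n)
    rw [ArithmeticFunction.sigma_zero_apply, card_divisors_of_squarefree hsq]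
    push_cast
    have h2 : (2 : ℝ) ^ (k * n.primeFactors.card) ≤
        2 ^ (2 * k + (dsel n).primeFactors.card * (3 * k)) :=
      pow_le_pow_right₀ one_le_two (by nlinarith [hcard])
    refine h2.trans (le_of_eq ?_)
    rw [pow_add, pow_mul, pow_mul]
    norm_num
  -- `d_n ∈ S` and `d_n ∣ n`
  have hmaps : ∀ n ∈ Ioc 0 X, dsel n ∈ S := by
    intro n hn
    have hn' := Finset.mem_Ioc.mp hn
    have hn0 : n ≠ 0 := hn'.1.ne'
    obtain ⟨hdvd, -, hcube, -⟩ := hdsel n hn0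
    have hd0 : dsel n ≠ 0 := ne_zero_of_dvd_ne_zero hn0 hdvd
    refine Finset.mem_Icc.mpr ⟨Nat.one_le_iff_ne_zero.mpr hd0, Nat.le_floor ?_⟩
    have hnx : (n : ℝ) ≤ x := le_trans (by exact_mod_cast hn'.2) (Nat.floor_le hx)
    have h3 : ((dsel n : ℝ)) ^ (3 : ℕ) ≤ x := le_trans (by exact_mod_cast hcube) hnx
    calc (dsel n : ℝ) = (((dsel n : ℝ)) ^ (3 : ℕ)) ^ (1 / 3 : ℝ) := by
          rw [← Real.rpow_natCast, ← Real.rpow_mul (Nat.cast_nonneg _)]; norm_num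
      _ ≤ x ^ (1 / 3 : ℝ) := Real.rpow_le_rpow (by positivity) h3 (by norm_num)
  calc ∑ n ∈ Ioc 0 X, A.a n * (2 : ℝ) ^ (k * n.primeFactors.card)
      ≤ ∑ n ∈ Ioc 0 X, A.a n * ((4 : ℝ) ^ k * ((σ 0 (dsel n) : ℝ)) ^ (3 * k)) :=
        Finset.sum_le_sum hpt
    _ = ∑ d ∈ S, ∑ n ∈ (Ioc 0 X).filter (fun n => dsel n = d),
          A.a n * ((4 : ℝ) ^ k * ((σ 0 (dsel n) : ℝ)) ^ (3 * k)) :=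
        (Finset.sum_fiberwise_of_maps_to hmaps _).symm
    _ = ∑ d ∈ S, (4 : ℝ) ^ k * ((σ 0 d : ℝ)) ^ (3 * k) *
          ∑ n ∈ (Ioc 0 X).filter (fun n => dsel n = d), A.a n := by
        refine Finset.sum_congr rfl fun d _ => ?_
        rw [Finset.mul_sum]
        refine Finset.sum_congr rfl fun n hn => ?_
        rw [(Finset.mem_filter.mp hn).2]; ring
    _ ≤ ∑ d ∈ S, (4 : ℝ) ^ k * ((σ 0 d : ℝ)) ^ (3 * k) * A.congrSum d x := by
        refine Finset.sum_le_sum fun d _ => mul_le_mul_of_nonneg_left ?_ (by positivity)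
        refine Finset.sum_le_sum_of_subset_of_nonneg (fun n hn => ?_) fun n _ _ => A.a_nonneg n
        have hn' := Finset.mem_filter.mp hn
        refine Finset.mem_filter.mpr ⟨hn'.1, ?_⟩
        rw [← hn'.2]
        exact (hdsel n (Finset.mem_Ioc.mp hn'.1).1.ne').1
    _ ≤ ∑ d ∈ S, (4 : ℝ) ^ k * ((σ 0 d : ℝ)) ^ (3 * k) * (K₈ * (σ 0 d : ℝ) ^ 8 / d * A.size x) := by
        refine Finset.sum_le_sum fun d hd => mul_le_mul_of_nonneg_left ?_ (by positivity)
        have hd' := Finset.mem_Icc.mp hd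
        exact h16 d hd'.1 ((Nat.le_floor_iff (by positivity)).mp hd'.2)
    _ = 4 ^ k * K₈ * (∑ d ∈ S, (σ 0 d : ℝ) ^ (3 * k + 8) / d) * A.size x := by
        rw [Finset.mul_sum, Finset.sum_mul]
        refine Finset.sum_congr rfl fun d _ => ?_
        rw [pow_add]; ring

end SieveSequence

/-! ### `g ≥ 0` on cubefree moduli and the Euler-product bound for `∑_{b cubefree} c^{ω(b)} g(b)` -/

variable {g : ArithmeticFunction ℝ}

/-- `g(b) ≥ 0` for cubefree `b` under (2.4) (`g(b) = ∏_{p^k ∥ b} g(p^k)` with `k ≤ 2`). [folklore] -/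
theorem density_nonneg_of_isCubefree (hg : g.IsMultiplicative)
    (h24 : ∀ p : ℕ, p.Prime → 0 ≤ g (p ^ 2) ∧ g (p ^ 2) ≤ g p ∧ g p < 1) {b : ℕ}
    (hb : IsCubefree b) : 0 ≤ g b := by
  rcases eq_or_ne b 0 with rfl | hb0
  · simp
  rw [ArithmeticFunction.IsMultiplicative.multiplicative_factorization g hg hb0, Finsupp.prod]
  refine Finset.prod_nonneg fun p hp => ?_
  have hp' : p.Prime := Nat.prime_of_mem_primeFactors (by rwa [Nat.support_factorization] at hp)
  have hk : b.factorization p ≤ 2 := hb p (by rwa [Nat.support_factorization] at hp)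
  have hk1 : 1 ≤ b.factorization p := Nat.one_le_iff_ne_zero.mpr (Finsupp.mem_support_iff.mp hp)
  interval_cases h : b.factorization p
  · simp only [pow_one]; exact (h24 p hp').1.trans (h24 p hp').2.1
  · exact (h24 p hp').1

/-- For coprime `a, b` and a prime factor `p` of `a`: `v_p(ab) = v_p(a)`. [folklore] -/
theorem factorization_mul_apply_of_mem_left {a b p : ℕ} (hab : a.Coprime b) (hp : p ∈ a.primeFactors) :
    (a * b).factorization p = a.factorization p := by
  rw [Nat.factorization_mul_of_coprime hab, Finsupp.add_apply,
    Nat.factorization_eq_zero_of_not_dvd (n := b) (fun h => ?_), add_zero]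
  exact (Nat.prime_of_mem_primeFactors hp).one_lt.ne'
    (Nat.Coprime.eq_one_of_dvd (Nat.Coprime.coprime_dvd_left (Nat.dvd_of_mem_primeFactors hp) hab) h)

/-- Cubefreeness of a product of coprime nonzero factors. [folklore] -/
theorem isCubefree_mul_iff_of_coprime {a b : ℕ} (ha : a ≠ 0) (hb : b ≠ 0) (hab : a.Coprime b) :
    IsCubefree (a * b) ↔ IsCubefree a ∧ IsCubefree b := by
  unfold IsCubefree
  rw [Nat.primeFactors_mul ha hb, Finset.forall_mem_union]
  refine and_congr (forall₂_congr fun p hp => ?_) (forall₂_congr fun p hp => ?_)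
  · rw [factorization_mul_apply_of_mem_left hab hp]
  · rw [mul_comm, factorization_mul_apply_of_mem_left hab.symm hp]

/-- The weight `h(b) = [b cubefree] c^{ω(b)} g(b)` is multiplicative on coprime arguments. [folklore] -/
theorem cubefreeWeight_mul (hg : g.IsMultiplicative) (c : ℝ) {a b : ℕ} (hab : a.Coprime b) :
    (if IsCubefree (a * b) then c ^ (a * b).primeFactors.card * g (a * b) else 0) =
      (if IsCubefree a then c ^ a.primeFactors.card * g a else 0) *
        (if IsCubefree b then c ^ b.primeFactors.card * g b else 0) := by
  rcases eq_or_ne a 0 with rfl | ha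
  · simp [(Nat.coprime_zero_left _).mp hab]
  rcases eq_or_ne b 0 with rfl | hb
  · simp [(Nat.coprime_zero_right _).mp hab]
  by_cases hca : IsCubefree a
  · by_cases hcb : IsCubefree b
    · rw [if_pos ((isCubefree_mul_iff_of_coprime ha hb hab).mpr ⟨hca, hcb⟩), if_pos hca, if_pos hcb,
        Nat.primeFactors_mul ha hb, Finset.card_union_of_disjoint hab.disjoint_primeFactors,
        pow_add, hg.map_mul_of_coprime hab]
      ring
    · rw [if_neg (fun h => hcb ((isCubefree_mul_iff_of_coprime ha hb hab).mp h).2), if_neg hcb,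
        mul_zero]
  · rw [if_neg (fun h => hca ((isCubefree_mul_iff_of_coprime ha hb hab).mp h).1), if_neg hca,
      zero_mul]

/-- The local factor of the weight: `∑_{k ≤ K} h(p^k) ≤ 1 + c g(p) + c g(p²)` (`h(p^k) = 0` for
`k ≥ 3`). [folklore] -/
theorem sum_range_cubefreeWeight_prime_pow_le (hg : g.IsMultiplicative)
    (h24 : ∀ p : ℕ, p.Prime → 0 ≤ g (p ^ 2) ∧ g (p ^ 2) ≤ g p ∧ g p < 1) {c : ℝ} (hc : 0 ≤ c)
    {p : ℕ} (hp : p.Prime) (K : ℕ) :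
    ∑ k ∈ range (K + 1), (if IsCubefree (p ^ k) then c ^ (p ^ k).primeFactors.card * g (p ^ k)
      else 0) ≤ 1 + c * g p + c * g (p ^ 2) := by
  set h : ℕ → ℝ := fun n => if IsCubefree n then c ^ n.primeFactors.card * g n else 0 with hh
  have h0 : ∀ n, 0 ≤ h n := fun n => by
    simp only [hh]
    split_ifs with hcf
    · exact mul_nonneg (pow_nonneg hc _) (density_nonneg_of_isCubefree hg h24 hcf)
    · exact le_rfl
  have hzero : ∀ k, 3 ≤ k → h (p ^ k) = 0 := fun k hk => by
    simp only [hh]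
    rw [if_neg]
    intro hcf
    have := hcf p (by rw [Nat.primeFactors_prime_pow (by omega) hp]; exact Finset.mem_singleton_self p)
    rw [hp.factorization_pow, Finsupp.single_eq_same] at this
    omega
  -- drop the terms `k ≥ 3` and compare with `range 3`
  have hsplit : ∑ k ∈ range (K + 1), h (p ^ k) = ∑ k ∈ (range (K + 1)).filter (· < 3), h (p ^ k) := by
    rw [← Finset.sum_filter_add_sum_filter_not _ (· < 3)]
    rw [Finset.sum_eq_zero (s := (range (K + 1)).filter fun k => ¬k < 3) fun k hk =>
      hzero k (not_lt.mp (Finset.mem_filter.mp hk).2), add_zero]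
  change ∑ k ∈ range (K + 1), h (p ^ k) ≤ _
  rw [hsplit]
  calc ∑ k ∈ (range (K + 1)).filter (· < 3), h (p ^ k) ≤ ∑ k ∈ range 3, h (p ^ k) :=
        Finset.sum_le_sum_of_subset_of_nonneg (fun k hk => Finset.mem_range.mpr
          (Finset.mem_filter.mp hk).2) fun k _ _ => h0 _
    _ = h 1 + h p + h (p ^ 2) := by
        rw [Finset.sum_range_succ, Finset.sum_range_succ, Finset.sum_range_one, pow_zero, pow_one]
    _ ≤ 1 + c * g p + c * g (p ^ 2) := by
        have e1 : h 1 = 1 := by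
          simp only [hh]
          rw [if_pos (show IsCubefree 1 from fun q hq => by simp at hq)]
          simp [hg.map_one]
        have e2 : h p ≤ c * g p := by
          simp only [hh]
          split_ifs
          · rw [hp.primeFactors, Finset.card_singleton, pow_one]
          · exact mul_nonneg hc ((h24 p hp).1.trans (h24 p hp).2.1)
        have e3 : h (p ^ 2) ≤ c * g (p ^ 2) := by
          simp only [hh]
          split_ifs
          · rw [Nat.primeFactors_prime_pow two_ne_zero hp, Finset.card_singleton, pow_one]
          · exact mul_nonneg hc (h24 p hp).1
        linarith

/-- **Euler-product bound for cubefree moduli** (FI p. 1060: "`∑³_{d} τ(d)^{10} g(d) ≤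
∏_{p ≤ x} (1 + 2^{10} g(p) + 3^{10} g(p²))`", here with the weight `c^{ω}`): for `c ≥ 0`,
`∑_{b ≤ M, b cubefree} c^{ω(b)} g(b) ≤ ∏_{p ≤ M} (1 + c g(p) + c g(p²))`.
[cite: FriedlanderIwaniecASP1998, §9 p. 1060] -/
theorem sum_cubefree_pow_mul_density_le (hg : g.IsMultiplicative)
    (h24 : ∀ p : ℕ, p.Prime → 0 ≤ g (p ^ 2) ∧ g (p ^ 2) ≤ g p ∧ g p < 1) {c : ℝ} (hc : 0 ≤ c)
    (M : ℕ) :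
    ∑ b ∈ (Icc 1 M).filter IsCubefree, c ^ b.primeFactors.card * g b ≤
      ∏ p ∈ Nat.primesLE M, (1 + c * g p + c * g (p ^ 2)) := by
  set h : ℕ → ℝ := fun n => if IsCubefree n then c ^ n.primeFactors.card * g n else 0 with hh
  have h0 : ∀ n, 0 ≤ h n := fun n => by
    simp only [hh]
    split_ifs with hcf
    · exact mul_nonneg (pow_nonneg hc _) (density_nonneg_of_isCubefree hg h24 hcf)
    · exact le_rfl
  have h1 : h 1 = 1 := by
    simp only [hh]
    rw [if_pos (show IsCubefree 1 from fun q hq => by simp at hq)]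
    simp [hg.map_one]
  have hmul : ∀ a b : ℕ, a.Coprime b → h (a * b) = h a * h b := fun a b hab =>
    cubefreeWeight_mul hg c hab
  have hsum : ∑ b ∈ (Icc 1 M).filter IsCubefree, c ^ b.primeFactors.card * g b =
      ∑ b ∈ Icc 1 M, h b := by
    rw [Finset.sum_filter]
  rw [hsum]
  refine (sum_Icc_le_prod_primesLE_sum h0 h1 hmul M).trans ?_
  refine Finset.prod_le_prod (fun p _ => Finset.sum_nonneg fun k _ => h0 _) fun p hp => ?_
  exact sum_range_cubefreeWeight_prime_pow_le hg h24 hc (Nat.prime_of_mem_primesLE hp) _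

/-- `∏_{p ≤ M} (1 + c g(p) + c g(p²)) ≤ exp(c ∑_{p ≤ M} g(p) + c ∑_{p ≤ M} g(p²))`. [folklore] -/
theorem prod_one_add_density_le_exp
    (h24 : ∀ p : ℕ, p.Prime → 0 ≤ g (p ^ 2) ∧ g (p ^ 2) ≤ g p ∧ g p < 1) {c : ℝ} (hc : 0 ≤ c)
    (M : ℕ) :
    ∏ p ∈ Nat.primesLE M, (1 + c * g p + c * g (p ^ 2)) ≤
      Real.exp (c * ∑ p ∈ Nat.primesLE M, g p + c * ∑ p ∈ Nat.primesLE M, g (p ^ 2)) := by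
  have h := prod_one_add_le_exp_sum (Nat.primesLE M) (f := fun p => c * g p + c * g (p ^ 2))
    fun p hp => by
      have h' := h24 p (Nat.prime_of_mem_primesLE hp)
      exact add_nonneg (mul_nonneg hc (h'.1.trans h'.2.1)) (mul_nonneg hc h'.1)
  simp only [← add_assoc] at h
  rw [Finset.sum_add_distrib, ← Finset.mul_sum, ← Finset.mul_sum] at h
  exact h

end Literature.NumberTheory.Sieve
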